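import Mathlib.Analysis.SpecialFunctions.Pow.Real
import Mathlib.Topology.Order.IntermediateValue
import Mathlib.Order.ConditionallyCompleteLattice.Basic
import HarnessLib

/-!
# Grönwall for two-point inequalities with a variable rate

Analysis/FluidPDE support file (serves the discharge of the named fact
`Literature.Analysis.FluidPDE.cheskidov_dai_occupation_regular` — Cheskidov–Dai, arXiv:1507.06611 =
Proc. Edinburgh Math. Soc. (2025), Thm. 1.1). The paper integrates the differential inequality (3.8),
`d/dt ‖u‖²_{H^s} ≤ C f(t) ‖u‖²_{H^s}` with the TIME-DEPENDENT low-mode rate `f(t) = ∑_{q ≤ Q(t)} λ_q‖u_q‖_∞`,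
"by Grönwall's inequality". In the tree the energy inequality is available in two-point form with a
supremum (`CheskidovShvydkoyApriori`, `SupGronwall`: constant rates). This file proves the variable-rate
version in the abstract (`le_two_mul_rpow_of_two_point`): if `f(t) ≤ f(s) + ω(s,t) · sup_{[s,t]} f` for an
interval functional `ω ≥ 0` which is superadditive and continuous in its second argument, then
`f(t) ≤ 2 f(a) · 4^{ω(a,t)}` — by induction on `⌈2ω⌉`, cutting at `ω = 1/2` with the intermediate value
theorem. No integrability or measurability of a rate is involved: in the application
(`CheskidovDaiApriori.lean`) `ω(s,t)` is a constant times a LOWER Lebesgue integral.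

Used by `CheskidovDaiCovered.dyadicF_toReal_le_of_covered` (the bootstrap on covered intervals).

(Re-filed 2026-08-24 to re-trigger the module build.)

## References

* A. Cheskidov, M. Dai, arXiv:1507.06611 = Proc. Edinburgh Math. Soc. (2025), §3.1 (Grönwall step).
  [CheskidovDai2015]
-/

noncomputable section

open Set

namespace Literature.Analysis.FluidPDE

/-! ## Grönwall for two-point inequalities with a variable rate -/

section Gronwall

variable {f : ℝ → ℝ} {ω : ℝ → ℝ → ℝ} {a b : ℝ}

/-- The short-interval step: if `f(t') ≤ f(s) + ω(s,t') sup_{[s,t']} f` on `[s,t]`, `ω(s,·) ≤ 1/2` there,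
and `f ≥ 0` is bounded on `[s,t]`, then `sup_{[s,t]} f ≤ 2 f(s)`. [folklore] -/
private theorem sSup_le_two_mul_of_small {s t B : ℝ} (hst : s ≤ t)
    (hB : ∀ τ ∈ Icc s t, f τ ≤ B) (hf0 : ∀ τ ∈ Icc s t, 0 ≤ f τ)
    (hω : ∀ t' ∈ Icc s t, 0 ≤ ω s t' ∧ ω s t' ≤ 1 / 2)
    (h2 : ∀ t' ∈ Icc s t, f t' ≤ f s + ω s t' * sSup (f '' Icc s t')) :
    ∀ τ ∈ Icc s t, f τ ≤ 2 * f s := by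
  set S := sSup (f '' Icc s t) with hS
  have hne : (f '' Icc s t).Nonempty := ⟨f s, s, ⟨le_rfl, hst⟩, rfl⟩
  have hbdd : BddAbove (f '' Icc s t) := ⟨B, by rintro _ ⟨τ, hτ, rfl⟩; exact hB τ hτ⟩
  have hfS : ∀ τ ∈ Icc s t, f τ ≤ S := fun τ hτ => le_csSup hbdd ⟨τ, hτ, rfl⟩
  have hS0 : 0 ≤ S := (hf0 s ⟨le_rfl, hst⟩).trans (hfS s ⟨le_rfl, hst⟩)
  -- `S ≤ f s + S/2`
  have hSle : S ≤ f s + (1 / 2) * S := by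
    refine csSup_le hne ?_
    rintro _ ⟨t', ht', rfl⟩
    have hsub : sSup (f '' Icc s t') ≤ S :=
      csSup_le_csSup hbdd ⟨f s, s, ⟨le_rfl, ht'.1⟩, rfl⟩ (image_mono (Icc_subset_Icc le_rfl ht'.2))
    have hsub0 : 0 ≤ sSup (f '' Icc s t') :=
      (hf0 s ⟨le_rfl, hst⟩).trans (le_csSup (hbdd.mono (image_mono (Icc_subset_Icc le_rfl ht'.2))) ⟨s, ⟨le_rfl, ht'.1⟩, rfl⟩)
    calc f t' ≤ f s + ω s t' * sSup (f '' Icc s t') := h2 t' ht'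
      _ ≤ f s + (1 / 2) * S := by
          have hprod : ω s t' * sSup (f '' Icc s t') ≤ (1 / 2) * S :=
            calc ω s t' * sSup (f '' Icc s t') ≤ (1 / 2) * sSup (f '' Icc s t') :=
                  mul_le_mul_of_nonneg_right (hω t' ht').2 hsub0
              _ ≤ (1 / 2) * S := by gcongr
          linarith
  intro τ hτ
  have := hfS τ hτ
  linarith

/-- **Grönwall for two-point inequalities with a variable rate.** Let `f ≥ 0` be bounded on `[a, b]` and
let `ω(s,t) ≥ 0` (`a ≤ s ≤ t ≤ b`) be superadditive, `ω(s,t) + ω(t,u) ≤ ω(s,u)`, with `τ ↦ ω(s,τ)`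
continuous on `[s, b]` and `ω(s,s) = 0`. If `f(t) ≤ f(s) + ω(s,t) · sup_{[s,t]} f` for all
`a ≤ s ≤ t ≤ b`, then `f(t) ≤ 2 f(a) · 4^{ω(a,t)}` on `[a, b]`. With `ω(s,t) = C ∫_s^t φ` this is the
classical `f(t) ≤ 2 f(a) e^{(2 ln 2) C ∫ φ}`; the point is that `ω` need not come from an integrable
rate (Cheskidov–Dai's rate `f(t) = ∑_{q ≤ Q(t)} λ_q ‖u_q‖_∞` is handled through lower integrals).
[cite: CheskidovDai2015, §3.1 (Grönwall step)] -/
theorem le_two_mul_rpow_of_two_point (hf0 : ∀ τ ∈ Icc a b, 0 ≤ f τ) (hB : ∃ B, ∀ τ ∈ Icc a b, f τ ≤ B)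
    (hω0 : ∀ s t, a ≤ s → s ≤ t → t ≤ b → 0 ≤ ω s t)
    (hωadd : ∀ s t u, a ≤ s → s ≤ t → t ≤ u → u ≤ b → ω s t + ω t u ≤ ω s u)
    (hωcont : ∀ s, a ≤ s → s ≤ b → ContinuousOn (ω s) (Icc s b))
    (hω00 : ∀ s, a ≤ s → s ≤ b → ω s s = 0)
    (h2p : ∀ s t, a ≤ s → s ≤ t → t ≤ b → f t ≤ f s + ω s t * sSup (f '' Icc s t))
    {t : ℝ} (ht : t ∈ Icc a b) :
    f t ≤ 2 * f a * (4 : ℝ) ^ (ω a t) := by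
  obtain ⟨B, hB⟩ := hB
  have h4 : (1 : ℝ) ≤ 4 := by norm_num
  -- monotonicity of `ω` in the second argument
  have hωmono : ∀ s t t', a ≤ s → s ≤ t' → t' ≤ t → t ≤ b → ω s t' ≤ ω s t := by
    intro s t t' has hst' ht't htb
    have h1 := hωadd s t' t has hst' ht't htb
    have h2 := hω0 t' t (has.trans hst') ht't htb
    linarith
  -- the short-interval step, everywhere
  have hbase : ∀ s t, a ≤ s → s ≤ t → t ≤ b → ω s t ≤ 1 / 2 → ∀ τ ∈ Icc s t, f τ ≤ 2 * f s := by
    intro s t has hst htb hω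
    refine sSup_le_two_mul_of_small hst (fun τ hτ => hB τ ⟨has.trans hτ.1, hτ.2.trans htb⟩)
      (fun τ hτ => hf0 τ ⟨has.trans hτ.1, hτ.2.trans htb⟩)
      (fun t' ht' => ⟨hω0 s t' has ht'.1 (ht'.2.trans htb), (hωmono s t t' has ht'.1 ht'.2 htb).trans hω⟩)
      fun t' ht' => h2p s t' has ht'.1 (ht'.2.trans htb)
  -- induction on `⌈2ω⌉`
  have hclaim : ∀ n : ℕ, ∀ s t, a ≤ s → s ≤ t → t ≤ b → ω s t ≤ (n + 1) / 2 →
      f t ≤ 2 * f s * (4 : ℝ) ^ (ω s t) := by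
    intro n
    induction n with
    | zero =>
      intro s t has hst htb hω
      have hω' : ω s t ≤ 1 / 2 := by norm_num at hω; linarith
      have h1 : f t ≤ 2 * f s := hbase s t has hst htb hω' t ⟨hst, le_rfl⟩
      have h2 : (1 : ℝ) ≤ (4 : ℝ) ^ (ω s t) := Real.one_le_rpow h4 (hω0 s t has hst htb)
      have h3 : 0 ≤ 2 * f s := by have := hf0 s ⟨has, hst.trans htb⟩; linarith
      nlinarith
    | succ n ih =>
      intro s t has hst htb hω
      by_cases hsmall : ω s t ≤ (n + 1) / 2
      · exact ih s t has hst htb hsmall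
      push Not at hsmall
      have hhalf : 1 / 2 ≤ ω s t := by
        have : (0 : ℝ) ≤ n := n.cast_nonneg
        linarith
      -- cut at `ω(s, t₁) = 1/2`
      have hivt : ∃ t₁ ∈ Icc s t, ω s t₁ = 1 / 2 := by
        have hcont : ContinuousOn (ω s) (Icc s t) := (hωcont s has (hst.trans htb)).mono (Icc_subset_Icc le_rfl htb)
        have hmem : (1 / 2 : ℝ) ∈ Icc (ω s s) (ω s t) := ⟨by rw [hω00 s has (hst.trans htb)]; norm_num, hhalf⟩
        exact intermediate_value_Icc hst hcont hmem
      obtain ⟨t₁, ht₁, hωt₁⟩ := hivt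
      have h1 : f t₁ ≤ 2 * f s := hbase s t₁ has ht₁.1 (ht₁.2.trans htb) hωt₁.le t₁ ⟨ht₁.1, le_rfl⟩
      have hω2 : ω t₁ t ≤ ω s t - 1 / 2 := by
        have := hωadd s t₁ t has ht₁.1 ht₁.2 htb
        linarith
      have hω2' : ω t₁ t ≤ (n + 1) / 2 := by push_cast at hω; linarith
      have h2 : f t ≤ 2 * f t₁ * (4 : ℝ) ^ (ω t₁ t) := ih t₁ t (has.trans ht₁.1) ht₁.2 htb hω2'
      have h3 : (4 : ℝ) ^ (ω t₁ t) ≤ (4 : ℝ) ^ (ω s t - 1 / 2) := Real.rpow_le_rpow_of_exponent_le h4 hω2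
      have h5 : (4 : ℝ) ^ (ω s t - 1 / 2) = (4 : ℝ) ^ (ω s t) / 2 := by
        rw [Real.rpow_sub (by norm_num : (0 : ℝ) < 4), show (4 : ℝ) ^ ((1 : ℝ) / 2) = 2 by
          rw [show (4 : ℝ) = 2 ^ (2 : ℕ) by norm_num, ← Real.rpow_natCast, ← Real.rpow_mul zero_le_two]; norm_num]
      have hft₁ : 0 ≤ f t₁ := hf0 t₁ ⟨has.trans ht₁.1, ht₁.2.trans htb⟩
      have hfs : 0 ≤ f s := hf0 s ⟨has, hst.trans htb⟩
      have h40 : 0 ≤ (4 : ℝ) ^ (ω t₁ t) := Real.rpow_nonneg (by norm_num) _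
      calc f t ≤ 2 * f t₁ * (4 : ℝ) ^ (ω t₁ t) := h2
        _ ≤ 2 * (2 * f s) * (4 : ℝ) ^ (ω s t - 1 / 2) := by gcongr
        _ = 2 * f s * (4 : ℝ) ^ (ω s t) := by rw [h5]; ring
  -- apply with `n = ⌈2 ω(a,t)⌉`
  obtain ⟨n, hn⟩ := exists_nat_ge (2 * ω a t)
  exact hclaim n a t le_rfl ht.1 ht.2 (by linarith)

end Gronwall

end Literature.Analysis.FluidPDE

end
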